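import Mathlib
import Summits.MatrixMultiplication.Statement
import Summits.MatrixMultiplication.MatrixMultiplication.Theorems.GraphEquationsDegreeFourMasking
import Summits.MatrixMultiplication.MatrixMultiplication.Theorems.GraphEquationsRigidQuadric

/-!
# Chains are masked to every order yet purified in one step (`GraphEquations`, kernel M73)

Decomp-mm node «GraphEquations» (lens 5); attacked leaf `MultiplicityReduction`
(stmt-MatrixMultiplication-27806); target of the node, VERBATIM: `_root_.MatrixMultiplication`.

The join of M71 (`GraphEquationsDegreeFourMasking`) and M72 (`GraphEquationsRigidQuadric`): the chain
systems — correct, degree `4`, test ideal initially isolated to NO order `K < 2^{n²}` over ANY base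
pair — are RIGID QUADRIC (`chainTest_rigid`), hence purified by ONE constant vertical deflation step
at cost `4·cost + n²` (`exists_chainSystem_rigid`, `chain_masked_yet_purified`).  So for the degree
ladder above the cubic rung the right invariant is not the ORDER of isolation of the test ideal (void
by M71) but the NUMBER OF STEPS (horizontal rounds `X_v`, vertical steps `D_μ`) needed to purify:
`1` for pivot designs (M57–M66, horizontal), `1` for rigid quadric systems (M72, vertical).  Also
recorded: a REALISATION lemma for an arbitrary finite list of tests (`exists_realisation_list`, the
pattern of M44's `exists_eqSystem_of_affSystem` made generic).

No `sorry`.  Sources: [BurgisserClausenShokrollahi1997, Problem 16.3]; Leykin–Verschelde–Zhao 2006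
[doi:10.1016/j.tcs.2006.02.018].
-/

set_option linter.dupNamespace false

noncomputable section

open scoped BigOperators

namespace Summit.MatrixMultiplication.MatrixMultiplication.Theorems.GraphEquations

open MvPolynomial Matrix
open Literature.Computability.AlgebraicComplexity
open Literature.Computability.AlgebraicComplexity.ArithCircuit

variable {n : ℕ}

/-- **Realisation of a finite list of tests** by a fan-in-two program testing exactly them. -/
theorem exists_realisation_list (l : List (MvPolynomial (GraphVars n) ℂ)) :
    ∃ E : EqSystem n, E.circuit.IsFanInTwo ∧ (∀ j ∈ E.tests, E.testPoly j ∈ l) ∧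
      (∀ t ∈ l, ∃ j ∈ E.tests, E.testPoly j = t) := by
  obtain ⟨gs, idx, hfan, -, hval⟩ := exists_gates_exposing l
  refine ⟨⟨⟨gs, .const 0⟩, idx⟩, hfan, fun j hj => ?_, fun t ht => ?_⟩
  · have hm : (gateValues gs).getD j 0 ∈ l := by rw [← hval]; exact List.mem_map_of_mem hj
    exact hm
  · have hm : t ∈ idx.map fun j => (gateValues gs).getD j 0 := by rw [hval]; exact ht
    obtain ⟨j, hj, hjt⟩ := List.mem_map.1 hm
    exact ⟨j, hj, hjt⟩

/-- `matQuadPoly` of an elementary matrix is a monomial. -/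
theorem matQuadPoly_single (i j : Fin n × Fin n) (c : ℂ) :
    matQuadPoly (Matrix.single i j c) = C c * X i * X j := by
  classical
  unfold matQuadPoly
  rw [Finset.sum_eq_single i, Finset.sum_eq_single j]
  · rw [Matrix.single_apply_same]
  · intro j' _ hj'; rw [Matrix.single_apply_of_ne (h := fun h => hj' h.2.symm), C_0, zero_mul, zero_mul]
  · simp
  · intro i' _ hi'
    exact Finset.sum_eq_zero fun j' _ => by
      rw [Matrix.single_apply_of_ne (h := fun h => hi' h.1.symm), C_0, zero_mul, zero_mul]
  · simp

/-- `linFormPoly` of a coordinate vector is the variable. -/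
theorem linFormPoly_single (p : Fin n × Fin n) : linFormPoly (Pi.single p 1) = X p := by
  classical
  unfold linFormPoly
  rw [Finset.sum_eq_single p]
  · simp
  · intro q _ hq; rw [Pi.single_eq_of_ne hq, C_0, zero_mul]
  · simp

/-- **Chain tests are rigid quadric**: `f_p − f_q² = e_p ⬝ f + ⟨f, −E_{qq} f⟩`, `f_p² = ⟨f, E_{pp} f⟩`. -/
theorem chainTest_rigid (i : Fin (n * n)) :
    ∃ (l : Fin n × Fin n → ℂ) (a : Matrix (Fin n × Fin n) (Fin n × Fin n) ℂ),
      chainTest n i = aeval (generator n) (linFormPoly l + matQuadPoly a) := by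
  classical
  unfold chainTest
  split_ifs with h
  · refine ⟨Pi.single (chainPos n i) 1, Matrix.single (chainPos n ⟨i.val + 1, h⟩)
      (chainPos n ⟨i.val + 1, h⟩) (-1), ?_⟩
    rw [linFormPoly_single, matQuadPoly_single, map_add, aeval_X, map_mul, map_mul, aeval_C, aeval_X]
    simp [sq, sub_eq_add_neg]
  · refine ⟨0, Matrix.single (chainPos n ⟨0, i.pos⟩) (chainPos n ⟨0, i.pos⟩) 1, ?_⟩
    have h0 : linFormPoly (0 : Fin n × Fin n → ℂ) = 0 := by simp [linFormPoly]
    rw [h0, zero_add, matQuadPoly_single, map_mul, map_mul, aeval_C, aeval_X, map_one, one_mul, sq]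

/-- **CHAIN SYSTEMS, rigid form**: for `n ≥ 1` a correct RIGID QUADRIC system (tests = chain tests)
whose test ideal is initially isolated to no order `K < 2^{n²}` over any base pair. -/
theorem exists_chainSystem_rigid (hn : 1 ≤ n) :
    ∃ E : EqSystem n, E.Correct ∧ E.IsRigidQuad ∧ (∀ j ∈ E.tests, ∃ i, E.testPoly j = chainTest n i) ∧
      ∀ K, K < 2 ^ (n * n) → ∀ y, ¬ E.IdealInitIsolatedAt K y := by
  classical
  obtain ⟨E, hfan, hto, hfrom⟩ := exists_realisation_list ((List.finRange (n * n)).map (chainTest n))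
  have hto' : ∀ j ∈ E.tests, ∃ i, E.testPoly j = chainTest n i := fun j hj => by
    obtain ⟨i, -, hi⟩ := List.mem_map.1 (hto j hj)
    exact ⟨i, hi.symm⟩
  have hfrom' : ∀ i, ∃ j ∈ E.tests, E.testPoly j = chainTest n i := fun i =>
    hfrom _ (List.mem_map_of_mem (List.mem_finRange i))
  refine ⟨E, ⟨hfan, Set.ext fun x => ⟨fun hx => ?_, fun hx j hj => ?_⟩⟩, fun j hj => ?_, hto',
    fun K hK y => ?_⟩
  · refine (chainTest_zero_iff x).1 fun i => ?_
    obtain ⟨j, hj, hji⟩ := hfrom' i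
    rw [← hji]; exact hx j hj
  · obtain ⟨i, hi⟩ := hto' j hj
    rw [hi]; exact (chainTest_zero_iff x).2 hx i
  · obtain ⟨i, hi⟩ := hto' j hj
    obtain ⟨l, a, hla⟩ := chainTest_rigid i
    exact ⟨l, a, hi.trans hla⟩
  · refine not_idealInitIsolatedAt_of_maskCert (lam := fun _ => 1) (w := chainWeight n) hK
      one_le_chainWeight (fun o => ?_)
      ⟨chainPos n ⟨n * n - 1, by have := Nat.mul_le_mul hn hn; omega⟩, ?_, by simp⟩
    · obtain ⟨i, hi⟩ := hto' (E.tests.get o) (List.get_mem _ _)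
      rw [hi]; exact X_pow_dvd_maskHom_chainTest i
    · rw [chainWeight_chainPos]; simp

/-- **MASKED TO EVERY ORDER, PURIFIED IN ONE STEP.**  For every `n ≥ 1` there are a correct degree-`4`
system `E` whose test ideal is initially isolated to NO order `K < 2^{n²}` over ANY base pair, and a
correct system `E'` — one constant vertical deflation step of `E`, cost `≤ 4·cost E + n²` — REDUCED
at the graph point over EVERY base pair. -/
theorem chain_masked_yet_purified (hn : 1 ≤ n) :
    ∃ E E' : EqSystem n, E.Correct ∧ E.IsDegLe 4 ∧ (∀ K, K < 2 ^ (n * n) → ∀ y, ¬ E.IdealInitIsolatedAt K y) ∧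
      E'.Correct ∧ (∀ y, E'.ReducedAt (graphPoint y)) ∧ E'.cost ≤ 4 * E.cost + n * n := by
  obtain ⟨E, hE, hR, -, hmask⟩ := exists_chainSystem_rigid hn
  obtain ⟨E', hE', hred, hcost⟩ := hR.exists_reduced_deflation hE
  exact ⟨E, E', hE, hR.isDegLe_four, hmask, hE', hred, hcost⟩

/-- The same in ladder currency: the order dial cannot see rung `4` (`¬ DegreeBoundsIsoOrder 4 K` for
all `K`, M71), while the rigid-quadric part of rung `4` — which contains every witness of that
blindness recorded so far — holds (`omega_le_of_eqAdmissibleRigidQuad`, M72). -/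
theorem rung_four_order_blind_rigid_part_holds :
    (∀ K, ¬ DegreeBoundsIsoOrder 4 K) ∧ (∀ β : ℝ, 2 ≤ β → EqAdmissibleRigidQuad β → omega ℂ ≤ β) :=
  ⟨not_degreeBoundsIsoOrder_four, fun _ hβ h => omega_le_of_eqAdmissibleRigidQuad hβ h⟩

end Summit.MatrixMultiplication.MatrixMultiplication.Theorems.GraphEquations

end
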